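import Literature.Probability.RandomPlanarGeometry.CardyFunctionIncBeta
import Mathlib.Analysis.SpecialFunctions.Trigonometric.Deriv
import Mathlib.Analysis.Calculus.Deriv.MeanValue

/-!
# `HalfPlaneMarkDensityLaw` (crux stmt-CriticalPhenomena-5661), line `Sketch`:
# the a-priori properties do NOT identify the profile (Apriori: a fake profile)

The a-priori programme shows that every joint subsequential scaling limit of the half-plane
crossing probability is (as a function of the cross-ratio) a profile `g` with `g 0 = 0`,
`g 1 = 1`, strictly increasing and continuous on `[0,1]`, differentiable with positive derivative
on `(0,1)`, and self-dual: `g (1 - u) = 1 - g u`.  This file records that these properties alone do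
not single out Cardy's function `F = cardyFunction`: the perturbed profile
`g u := Φ (F u)` with `Φ v := v + (1/10) · sin (2 π v)` has all of them (`Φ 0 = 0`, `Φ 1 = 1`,
`Φ' v = 1 + (π/5) cos (2 π v) ≥ 1 - π/5 > 0`, `Φ (1 - v) = 1 - Φ v`), yet `g u₁ = 1/4 + 1/10 ≠ F u₁`
at the point `u₁ ∈ (0,1)` where `F u₁ = 1/4` (intermediate value theorem).
-/

noncomputable section

namespace Summit.CriticalPhenomena.CardyFormulaZ2.Cruxes.HalfPlaneMarkDensityLaw.SketchLine

open Set Filter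
open scoped Topology
open Literature.Probability.RandomPlanarGeometry

namespace Apriori

/-- Derivative of the perturbation `Φ v = v + (1/10) sin (2 π v)`:
`Φ' v = 1 + (1/10) (cos (2 π v) · 2 π)` (chain rule). [folklore] -/
theorem hasDerivAt_fakePhi (v : ℝ) :
    HasDerivAt (fun v : ℝ ↦ v + 1 / 10 * Real.sin (2 * Real.pi * v))
      (1 + 1 / 10 * (Real.cos (2 * Real.pi * v) * (2 * Real.pi))) v := by
  have h1 : HasDerivAt (fun v : ℝ ↦ 2 * Real.pi * v) (2 * Real.pi) v := by
    simpa using (hasDerivAt_id v).const_mul (2 * Real.pi)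
  exact (hasDerivAt_id v).add (h1.sin.const_mul (1 / 10))

/-- The derivative `1 + (π/5) cos (2 π v)` of the perturbation `Φ` is positive, since
`cos ≥ -1` and `π ≤ 4 < 5`. [folklore] -/
theorem fakePhi_deriv_pos (v : ℝ) :
    0 < 1 + 1 / 10 * (Real.cos (2 * Real.pi * v) * (2 * Real.pi)) := by
  have hcos : 0 ≤ Real.cos (2 * Real.pi * v) + 1 := by
    linarith [Real.neg_one_le_cos (2 * Real.pi * v)]
  nlinarith [Real.pi_pos, Real.pi_le_four, mul_nonneg hcos Real.pi_pos.le]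

/-- The perturbation `Φ v = v + (1/10) sin (2 π v)` is strictly increasing on `ℝ`
(positive derivative). [folklore] -/
theorem strictMono_fakePhi :
    StrictMono (fun v : ℝ ↦ v + 1 / 10 * Real.sin (2 * Real.pi * v)) :=
  strictMono_of_deriv_pos fun v ↦ by
    rw [(hasDerivAt_fakePhi v).deriv]
    exact fakePhi_deriv_pos v

/-- The perturbation `Φ v = v + (1/10) sin (2 π v)` is continuous. [folklore] -/
theorem continuous_fakePhi :
    Continuous (fun v : ℝ ↦ v + 1 / 10 * Real.sin (2 * Real.pi * v)) := by
  fun_prop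

/-- The perturbation `Φ` is self-dual: `Φ (1 - v) = 1 - Φ v`, from
`sin (2 π - x) = - sin x`. [folklore] -/
theorem fakePhi_one_sub (v : ℝ) :
    (1 - v) + 1 / 10 * Real.sin (2 * Real.pi * (1 - v)) =
      1 - (v + 1 / 10 * Real.sin (2 * Real.pi * v)) := by
  rw [mul_sub, mul_one, Real.sin_two_pi_sub]
  ring

/-- **Non-identifiability of the profile by the a-priori properties.**  There is a profile
`g : ℝ → ℝ` different from Cardy's function somewhere on `(0,1)` which nevertheless has all the
a-priori properties of a half-plane crossing profile: `g 0 = 0`, `g 1 = 1`, strictly increasing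
and continuous on `[0,1]`, differentiable with positive derivative on `(0,1)`, and self-dual
`g (1 - u) = 1 - g u` on `[0,1]`.  Witness: `g := Φ ∘ F` with `Φ v = v + (1/10) sin (2 π v)`;
`g ≠ F` at the point of `(0,1)` where `F = 1/4`. [folklore] -/
theorem stub_fakeProfile : ∃ g : ℝ → ℝ, (∃ u ∈ Set.Ioo (0 : ℝ) 1, g u ≠ Literature.Probability.RandomPlanarGeometry.cardyFunction u) ∧ g 0 = 0 ∧ g 1 = 1 ∧ StrictMonoOn g (Set.Icc 0 1) ∧ ContinuousOn g (Set.Icc 0 1) ∧ (∀ u ∈ Set.Ioo (0 : ℝ) 1, DifferentiableAt ℝ g u ∧ 0 < deriv g u) ∧ ∀ u ∈ Set.Icc (0 : ℝ) 1, g (1 - u) = 1 - g u := by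
  have hF0 : cardyFunction 0 = 0 := cardyFunction_zero
  have hF1 : cardyFunction 1 = 1 := cardyFunction_one_holds
  have hFmono : StrictMonoOn cardyFunction (Icc 0 1) := strictMonoOn_cardyFunction_holds
  have hFcont : ContinuousOn cardyFunction (Icc 0 1) := continuousOn_cardyFunction_holds
  refine ⟨fun u ↦ cardyFunction u + 1 / 10 * Real.sin (2 * Real.pi * cardyFunction u),
    ?_, ?_, ?_, ?_, ?_, ?_, ?_⟩
  · -- the witness of non-identity: the point `u₁ ∈ (0,1)` with `F u₁ = 1/4`
    obtain ⟨u, hu, hFu⟩ : ∃ u ∈ Icc (0 : ℝ) 1, cardyFunction u = 1 / 4 := by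
      have hmem : (1 / 4 : ℝ) ∈ Icc (cardyFunction 0) (cardyFunction 1) := by
        rw [hF0, hF1]
        constructor <;> norm_num
      exact intermediate_value_Icc zero_le_one hFcont hmem
    have hu0 : u ≠ 0 := by
      rintro rfl
      rw [hF0] at hFu
      norm_num at hFu
    have hu1 : u ≠ 1 := by
      rintro rfl
      rw [hF1] at hFu
      norm_num at hFu
    refine ⟨u, ⟨lt_of_le_of_ne hu.1 (Ne.symm hu0), lt_of_le_of_ne hu.2 hu1⟩, ?_⟩
    have hsin : Real.sin (2 * Real.pi * (1 / 4)) = 1 := by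
      rw [show 2 * Real.pi * (1 / 4 : ℝ) = Real.pi / 2 by ring, Real.sin_pi_div_two]
    show cardyFunction u + 1 / 10 * Real.sin (2 * Real.pi * cardyFunction u) ≠ cardyFunction u
    rw [hFu, hsin]
    norm_num
  · -- `g 0 = 0`
    show cardyFunction 0 + 1 / 10 * Real.sin (2 * Real.pi * cardyFunction 0) = 0
    rw [hF0, mul_zero, Real.sin_zero, mul_zero, add_zero]
  · -- `g 1 = 1`
    show cardyFunction 1 + 1 / 10 * Real.sin (2 * Real.pi * cardyFunction 1) = 1
    rw [hF1, mul_one, Real.sin_two_pi, mul_zero, add_zero]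
  · -- strictly increasing on `[0,1]`
    exact strictMono_fakePhi.comp_strictMonoOn hFmono
  · -- continuous on `[0,1]`
    exact continuous_fakePhi.comp_continuousOn hFcont
  · -- differentiable with positive derivative on `(0,1)`
    intro u hu
    have hF : HasDerivAt cardyFunction (cardyConst / 3 * (u * (1 - u)) ^ (-(2 / 3 : ℝ))) u :=
      hasDerivAt_cardyFunction_holds hu
    have hg : HasDerivAt (fun u ↦ cardyFunction u + 1 / 10 * Real.sin (2 * Real.pi * cardyFunction u))
        ((1 + 1 / 10 * (Real.cos (2 * Real.pi * cardyFunction u) * (2 * Real.pi))) *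
          (cardyConst / 3 * (u * (1 - u)) ^ (-(2 / 3 : ℝ)))) u :=
      (hasDerivAt_fakePhi (cardyFunction u)).comp u hF
    refine ⟨hg.differentiableAt, ?_⟩
    rw [hg.deriv]
    refine mul_pos (fakePhi_deriv_pos _) (mul_pos (div_pos cardyConst_pos (by norm_num)) ?_)
    exact Real.rpow_pos_of_pos (mul_pos hu.1 (by linarith [hu.2])) _
  · -- self-duality on `[0,1]`
    intro u hu
    show cardyFunction (1 - u) + 1 / 10 * Real.sin (2 * Real.pi * cardyFunction (1 - u)) =
      1 - (cardyFunction u + 1 / 10 * Real.sin (2 * Real.pi * cardyFunction u))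
    rw [cardyFunction_one_sub_holds hu]
    exact fakePhi_one_sub _

end Apriori

end Summit.CriticalPhenomena.CardyFormulaZ2.Cruxes.HalfPlaneMarkDensityLaw.SketchLine
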